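import Mathlib
import Summits.Ventures.PercRepro.TriangleCapTopEight

/-!
# PercRepro — THE TOP VALUES OF THE `K₄⁻`-FREE CHERRY TABLE IN CHERRY FORM (p3, gen 50; part 220)

The statements of parts 208–218 in the table's own coordinates `cherries D = Σ_v C(d(v), 2)` (`2 · cherries +
Σ d = Σ d²`, `Σ d = 2 m`): the third, fourth and fifth values (`cherry_third_best_cherries` is in part 208;
`cherry_fourth_best_cherries`, `cherry_fifth_best_cherries`) and the top seven (`cherry_top_seven_cherries`) —
`2 · cherries + r (k − 1 − r) + g = m (k − 2)` in place of
`Σ d² + r (k − 1 − r) + g = m k`.  Axioms: standard.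
-/

namespace PercRepro

namespace TriangleCap

namespace C047

open Finset

/-- The translation of a gap statement to the cherry form (`k ≥ 2`): `Σ d² + X = m k ↔ 2 · cherries + X = m (k − 2)`. -/
theorem gap_eq_iff_cherries (k : ℕ) (hk : 2 ≤ k) (D : SimpleGraph (Fin k)) [DecidableRel D.Adj] (X : ℕ) :
    ∑ v, deg D v * deg D v + X = D.edgeFinset.card * k ↔ 2 * cherries D + X = D.edgeFinset.card * (k - 2) := by
  have hcard : Fintype.card (Fin k) = k := Fintype.card_fin k
  have := sum_deg_sq_eq_iff_cherries D X (by rw [hcard]; exact hk)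
  rw [hcard] at this
  exact this

/-- The translation of a gap bound to the cherry form (`k ≥ 2`). -/
theorem gap_le_iff_cherries (k : ℕ) (hk : 2 ≤ k) (D : SimpleGraph (Fin k)) [DecidableRel D.Adj] (X : ℕ) :
    ∑ v, deg D v * deg D v + X ≤ D.edgeFinset.card * k ↔ 2 * cherries D + X ≤ D.edgeFinset.card * (k - 2) := by
  have hcard : Fintype.card (Fin k) = k := Fintype.card_fin k
  have := sum_deg_sq_le_iff_cherries D X (by rw [hcard]; exact hk)
  rw [hcard] at this
  exact this

/-- **THE FOURTH-BEST VALUE, CHERRY FORM.** -/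
theorem cherry_fourth_best_cherries (k a r : ℕ) (ha3 : 3 ≤ a) (hr6 : 6 ≤ r) (hk : 2 * a + r ≤ k)
    (hk3 : a = 3 → r + 7 ≤ k) :
    (∀ (D : SimpleGraph (Fin k)) [DecidableRel D.Adj], K4mFree D → D.edgeFinset.card + r = a * (k - a) →
        2 * cherries D + r * (k - 1 - r) ≠ D.edgeFinset.card * (k - 2) →
        2 * cherries D + r * (k - 1 - r) + 2 * (r - 2) ≠ D.edgeFinset.card * (k - 2) →
        2 * cherries D + r * (k - 1 - r) + 2 * (r - 1) ≠ D.edgeFinset.card * (k - 2) →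
        2 * cherries D + r * (k - 1 - r) + min (4 * (r - 3)) (stabGapFull k a r) ≤
          D.edgeFinset.card * (k - 2)) ∧
      ∃ (D : SimpleGraph (Fin k)) (_ : DecidableRel D.Adj), K4mFree D ∧ D.edgeFinset.card + r = a * (k - a) ∧
        2 * cherries D + r * (k - 1 - r) + min (4 * (r - 3)) (stabGapFull k a r) =
          D.edgeFinset.card * (k - 2) := by
  have hk2 : 2 ≤ k := by omega
  obtain ⟨h1, D, inst, hK, hE, hS⟩ := cherry_fourth_best k a r ha3 hr6 hk hk3
  refine ⟨?_, D, inst, hK, hE, ?_⟩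
  · intro D _ hK hm hne1 hne2 hne3
    have hne1' : ∑ v, deg D v * deg D v + r * (k - 1 - r) ≠ D.edgeFinset.card * k :=
      fun h => hne1 ((gap_eq_iff_cherries k hk2 D (r * (k - 1 - r))).mp h)
    have hne2' : ∑ v, deg D v * deg D v + r * (k - 1 - r) + 2 * (r - 2) ≠ D.edgeFinset.card * k := fun h => by
      apply hne2
      rw [add_assoc]
      exact (gap_eq_iff_cherries k hk2 D (r * (k - 1 - r) + 2 * (r - 2))).mp (by rw [← add_assoc]; exact h)
    have hne3' : ∑ v, deg D v * deg D v + r * (k - 1 - r) + 2 * (r - 1) ≠ D.edgeFinset.card * k := fun h => by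
      apply hne3
      rw [add_assoc]
      exact (gap_eq_iff_cherries k hk2 D (r * (k - 1 - r) + 2 * (r - 1))).mp (by rw [← add_assoc]; exact h)
    have h := h1 D hK hm hne1' hne2' hne3'
    have := (gap_le_iff_cherries k hk2 D (r * (k - 1 - r) + min (4 * (r - 3)) (stabGapFull k a r))).mp
      (by rw [← add_assoc]; exact h)
    rw [add_assoc]
    exact this
  · have := (gap_eq_iff_cherries k hk2 D (r * (k - 1 - r) + min (4 * (r - 3)) (stabGapFull k a r))).mp
      (by rw [← add_assoc]; exact hS)
    rw [add_assoc]
    exact this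

/-- **THE FIFTH-BEST VALUE, CHERRY FORM.** -/
theorem cherry_fifth_best_cherries (k a r : ℕ) (ha3 : 3 ≤ a) (hr6 : 6 ≤ r) (hk : 2 * a + r ≤ k)
    (hk3 : a = 3 → r + 7 ≤ k) :
    (∀ (D : SimpleGraph (Fin k)) [DecidableRel D.Adj], K4mFree D → D.edgeFinset.card + r = a * (k - a) →
        2 * cherries D + r * (k - 1 - r) ≠ D.edgeFinset.card * (k - 2) →
        2 * cherries D + r * (k - 1 - r) + 2 * (r - 2) ≠ D.edgeFinset.card * (k - 2) →
        2 * cherries D + r * (k - 1 - r) + 2 * (r - 1) ≠ D.edgeFinset.card * (k - 2) →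
        2 * cherries D + r * (k - 1 - r) + min (4 * (r - 3)) (stabGapFull k a r) ≠
          D.edgeFinset.card * (k - 2) →
        2 * cherries D + r * (k - 1 - r) + min (4 * (r - 3) + 2) (stabGapFull k a r) ≤
          D.edgeFinset.card * (k - 2)) ∧
      ∃ (D : SimpleGraph (Fin k)) (_ : DecidableRel D.Adj), K4mFree D ∧ D.edgeFinset.card + r = a * (k - a) ∧
        2 * cherries D + r * (k - 1 - r) + min (4 * (r - 3) + 2) (stabGapFull k a r) =
          D.edgeFinset.card * (k - 2) := by
  have hk2 : 2 ≤ k := by omega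
  obtain ⟨h1, D, inst, hK, hE, hS⟩ := cherry_fifth_best k a r ha3 hr6 hk hk3
  refine ⟨?_, D, inst, hK, hE, ?_⟩
  · intro D _ hK hm hne1 hne2 hne3 hne4
    have hne1' : ∑ v, deg D v * deg D v + r * (k - 1 - r) ≠ D.edgeFinset.card * k :=
      fun h => hne1 ((gap_eq_iff_cherries k hk2 D (r * (k - 1 - r))).mp h)
    have hne2' : ∑ v, deg D v * deg D v + r * (k - 1 - r) + 2 * (r - 2) ≠ D.edgeFinset.card * k := fun h => by
      apply hne2
      rw [add_assoc]
      exact (gap_eq_iff_cherries k hk2 D (r * (k - 1 - r) + 2 * (r - 2))).mp (by rw [← add_assoc]; exact h)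
    have hne3' : ∑ v, deg D v * deg D v + r * (k - 1 - r) + 2 * (r - 1) ≠ D.edgeFinset.card * k := fun h => by
      apply hne3
      rw [add_assoc]
      exact (gap_eq_iff_cherries k hk2 D (r * (k - 1 - r) + 2 * (r - 1))).mp (by rw [← add_assoc]; exact h)
    have hne4' : ∑ v, deg D v * deg D v + r * (k - 1 - r) + min (4 * (r - 3)) (stabGapFull k a r) ≠
        D.edgeFinset.card * k := fun h => by
      apply hne4
      rw [add_assoc]
      exact (gap_eq_iff_cherries k hk2 D (r * (k - 1 - r) + min (4 * (r - 3)) (stabGapFull k a r))).mp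
        (by rw [← add_assoc]; exact h)
    have h := h1 D hK hm hne1' hne2' hne3' hne4'
    have := (gap_le_iff_cherries k hk2 D (r * (k - 1 - r) + min (4 * (r - 3) + 2) (stabGapFull k a r))).mp
      (by rw [← add_assoc]; exact h)
    rw [add_assoc]
    exact this
  · have := (gap_eq_iff_cherries k hk2 D (r * (k - 1 - r) + min (4 * (r - 3) + 2) (stabGapFull k a r))).mp
      (by rw [← add_assoc]; exact hS)
    rw [add_assoc]
    exact this

/-- **THE TOP SEVEN VALUES, CHERRY FORM** (`r ≥ 10`, `6 (r − 4) ≤ stabGapFull k a r`). -/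
theorem cherry_top_seven_cherries (k a r : ℕ) (ha3 : 3 ≤ a) (hr10 : 10 ≤ r) (hk : 2 * a + r ≤ k)
    (hk3 : a = 3 → r + 7 ≤ k) (hgap : 6 * (r - 4) ≤ stabGapFull k a r) :
    (∀ (D : SimpleGraph (Fin k)) [DecidableRel D.Adj], K4mFree D → D.edgeFinset.card + r = a * (k - a) →
        D.edgeFinset.card * (k - 2) < 2 * cherries D + r * (k - 1 - r) + 6 * (r - 4) →
        ∃ g ∈ ({0, 2 * (r - 2), 2 * (r - 1), 4 * (r - 3), 4 * (r - 3) + 2, 4 * (r - 3) + 4,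
          4 * (r - 3) + 6} : Finset ℕ),
          2 * cherries D + r * (k - 1 - r) + g = D.edgeFinset.card * (k - 2)) ∧
      (∀ g ∈ ({0, 2 * (r - 2), 2 * (r - 1), 4 * (r - 3), 4 * (r - 3) + 2, 4 * (r - 3) + 4,
          4 * (r - 3) + 6} : Finset ℕ),
        ∃ (D : SimpleGraph (Fin k)) (_ : DecidableRel D.Adj), K4mFree D ∧ D.edgeFinset.card + r = a * (k - a) ∧
          2 * cherries D + r * (k - 1 - r) + g = D.edgeFinset.card * (k - 2)) := by
  have hk2 : 2 ≤ k := by omega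
  obtain ⟨h1, h2⟩ := cherry_top_seven k a r ha3 hr10 hk hk3 hgap
  refine ⟨?_, ?_⟩
  · intro D _ hK hm hlt
    have hlt' : D.edgeFinset.card * k < ∑ v, deg D v * deg D v + r * (k - 1 - r) + 6 * (r - 4) := by
      by_contra hle
      have := (gap_le_iff_cherries k hk2 D (r * (k - 1 - r) + 6 * (r - 4))).mp
        (by rw [← add_assoc]; exact not_lt.mp hle)
      omega
    obtain ⟨g, hg, h⟩ := h1 D hK hm hlt'
    refine ⟨g, hg, ?_⟩
    have := (gap_eq_iff_cherries k hk2 D (r * (k - 1 - r) + g)).mp (by rw [← add_assoc]; exact h)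
    rw [add_assoc]
    exact this
  · intro g hg
    obtain ⟨D, inst, hK, hE, hS⟩ := h2 g hg
    refine ⟨D, inst, hK, hE, ?_⟩
    have := (gap_eq_iff_cherries k hk2 D (r * (k - 1 - r) + g)).mp (by rw [← add_assoc]; exact hS)
    rw [add_assoc]
    exact this

end C047

end TriangleCap

end PercRepro
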